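import Summits.AtomisticToContinuum.Crystallization.Theorems.OverbindingBudgetAffineRunCutSheetCrossing

/-!
# `OverbindingBudget` / crux `RobustDefectLimitWindows` (stmt-AtomisticToContinuum-31280) — «RunCut»: BOND LINK (the sharp per-bond transport constant)

Support file (lens-4 g89 head start for part 23A «BOND CARRY»; memo `g89/memo/ATLAS-STAR-g89.md` §2 (B) and §5, certificate `g89/memo/star_kernel.py`;
order (2c), ρ₁ = 30).  SOURCE of every constant: the registrations `hf` (`dist (f v) (y j + ν_j·A v) ≤ ε·ν_j`, record `ε = 10⁻⁴`) exactly as in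
`…CompressedCutDict.dict_step/dict_base`, the frame clause `hA` (`‖A v − Q v‖ ≤ 10⁻³` on pattern points), the per-bond scale window
`9967/10⁴ ≤ ν_k/ν_j ≤ 10011/10⁴` (`…CompressedCutEstablish.bond_exact`), and ‖x‖² = 8/3 for the carried `{111}`-type model vectors
`x = (2/3)(u₁ + u₂ + u₃)` (a 60°-triple of first-shell labels) — nothing else.
§1 ★ `combo3_bound`, `combo4_bound` — the SHARP registration-combination bounds behind the per-bond constant 16/3·10⁻⁴ (memo §5 (K3)): for a bond
`j → k = f v_k` with back-pointer `w₀` (`f′ w₀ = y j`) and partnered labels `f′ w_r = f v_r`, and a combination `x′ = c₀ w₀ + Σ c_r w_r` of `k`'s labels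
with dictionary image `x = −c₀ v_k + Σ c_r (v_r − v_k)`,
  `‖ν_k·A′ x′ − ν_j·A x‖ ≤ ε·[ν_k(|c₀| + Σ|c_r|) + ν_j(Σ|c_r| + |c₀ + Σ c_r|)]`
— the registration of `k` at `j` is COMMON to all labels and enters ONCE (coefficient `c₀ + Σ c_r`); the per-label route through `dict_step`
(`2ε ν_j + ε ν_k` each) would give `ν_j(|c₀| + 2Σ|c_r|)` instead (worst 6 against 16/3, memo §5).  The vector identity is `module`, the rest triangle
inequalities.  §2 `face_link` / `quad_link`: the same in the registration language of `dict_step` (generic `ε`), and the record corollaries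
`face_link_record` (|c| = 2/3 thrice: `≤ 10⁻⁴(2ν_k + 10/3·ν_j)`, the 16/3) and `quad_link_record` (|c| = 2/3, 1/3, 2/3, 1/3 with zero sum:
`≤ 10⁻⁴(2ν_k + 2ν_j)`, the non-face fcc lines).
§3 the carried direction: `chord_sq` / ★ `chord_le` (‖û − v̂‖²·‖u‖‖v‖ ≤ ‖u − v‖², exact — the factor-2 Mathlib form is too weak here), `inner_unit_perturb`
(|⟪a, b⟫ − ⟪a′, b′⟫| ≤ ‖a − a′‖ + ‖b − b′‖ for unit `a′, b`), `near_isometry_combo3` + `norm_face_lower` (‖A x‖ ≥ 1.6309 when ‖A − Q‖ ≤ 10⁻³ on the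
three labels and ‖x‖² = 8/3), ★ `kappa_face` / `kappa_quad`: chord per bond `≤ 33/10⁵` (resp. `25/10⁵`) under the scale window.
§4 budget lines of order (2c) at `N_leg = 17` bonds (memo §5): `budget_kill` (1/3 + α + 17κ ≤ 87/250) and `budget_hub` (1/3 + α + 34κ ≤ 87/250) with
`α = 245/10⁵`, `κ = 33/10⁵` (the engine `…RunCutSheetCrossing.no_crossing` takes `c ≤ 87/250`).
Nearest in-tree prior art: `…BrittleRungDescentMieRungSoftCap.dist_normalize_ge` (a LOWER bound on radial projections; here the sharp upper bound),
`…CompressedCutDict.dict_step/dict_base` (the per-label residual bounds), `…CompressedCutEstablish.link_comp` (the op-norm link, (5/2)(2ε ν_j + ε ν_k)‖x‖ —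
too coarse for angles: 7.5·10⁻⁴ rad/bond).
[this file: 0 definitions, 22 theorems; imports tree `…RunCutSheetCrossing` only; standard axioms]
-/

namespace Summit.AtomisticToContinuum.Crystallization.Theorems.OverbindingBudgetAffineRunCutBondLink

open scoped InnerProductSpace
open Literature.Geometry.DiscreteGeometry (nearestDist)

local notation "E3" => EuclideanSpace ℝ (Fin 3)

/-! ## §1 The sharp registration-combination bounds -/

/-- Norm of a scalar combination of three vectors against bounds on the vectors. [this file · kind: glue] -/
theorem norm_combo3_le {e₀ e₁ e₂ : E3} {c₀ c₁ c₂ b₀ b₁ b₂ : ℝ} (h₀ : ‖e₀‖ ≤ b₀) (h₁ : ‖e₁‖ ≤ b₁) (h₂ : ‖e₂‖ ≤ b₂) :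
    ‖c₀ • e₀ + c₁ • e₁ + c₂ • e₂‖ ≤ |c₀| * b₀ + |c₁| * b₁ + |c₂| * b₂ := by
  refine (norm_add_le _ _).trans (add_le_add ((norm_add_le _ _).trans (add_le_add ?_ ?_)) ?_) <;>
    rw [norm_smul, Real.norm_eq_abs]
  · exact mul_le_mul_of_nonneg_left h₀ (abs_nonneg _)
  · exact mul_le_mul_of_nonneg_left h₁ (abs_nonneg _)
  · exact mul_le_mul_of_nonneg_left h₂ (abs_nonneg _)

/-- Four-vector version of `norm_combo3_le`. [this file · kind: glue] -/
theorem norm_combo4_le {e₀ e₁ e₂ e₃ : E3} {c₀ c₁ c₂ c₃ b₀ b₁ b₂ b₃ : ℝ} (h₀ : ‖e₀‖ ≤ b₀) (h₁ : ‖e₁‖ ≤ b₁) (h₂ : ‖e₂‖ ≤ b₂)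
    (h₃ : ‖e₃‖ ≤ b₃) : ‖c₀ • e₀ + c₁ • e₁ + c₂ • e₂ + c₃ • e₃‖ ≤ |c₀| * b₀ + |c₁| * b₁ + |c₂| * b₂ + |c₃| * b₃ := by
  refine (norm_add_le _ _).trans (add_le_add (norm_combo3_le h₀ h₁ h₂) ?_)
  rw [norm_smul, Real.norm_eq_abs]
  exact mul_le_mul_of_nonneg_left h₃ (abs_nonneg _)

/-- ★ **SHARP THREE-LABEL BOND LINK** (back-pointer `w₀` and two partnered labels `w_a, w_b`).  Frames `A` at `j` (scale `s = ν_j`) and `A′` at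
`k` (scale `s′ = ν_k`); `p_a = f v_a = f′ w_a`, `p_b` likewise; the six registration residuals are the hypotheses (`h₀`: `j` seen from `k`; `ha₁, hb₁`:
the partners seen from `k`; `ha₂, hb₂`: the same sites seen from `j`; `h₃`: `k` seen from `j`).  The residual of `k` at `j` enters once, with
coefficient `c₀ + c_a + c_b`. [this file · kind: new estimate] -/
theorem combo3_bound {A A' : E3 →ₗ[ℝ] E3} {s s' ε c₀ ca cb : ℝ} {yj yk pa pb vk va vb w₀ wa wb : E3}
    (h₀ : ‖yj - yk - s' • A' w₀‖ ≤ ε * s') (ha₁ : ‖pa - yk - s' • A' wa‖ ≤ ε * s') (hb₁ : ‖pb - yk - s' • A' wb‖ ≤ ε * s')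
    (ha₂ : ‖pa - yj - s • A va‖ ≤ ε * s) (hb₂ : ‖pb - yj - s • A vb‖ ≤ ε * s) (h₃ : ‖yk - yj - s • A vk‖ ≤ ε * s) :
    ‖s' • A' (c₀ • w₀ + ca • wa + cb • wb) - s • A (-(c₀ • vk) + ca • (va - vk) + cb • (vb - vk))‖ ≤
      ε * ((|c₀| + |ca| + |cb|) * s' + (|ca| + |cb| + |c₀ + ca + cb|) * s) := by
  have e : s' • A' (c₀ • w₀ + ca • wa + cb • wb) - s • A (-(c₀ • vk) + ca • (va - vk) + cb • (vb - vk)) =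
      -(c₀ • (yj - yk - s' • A' w₀) + ca • (pa - yk - s' • A' wa) + cb • (pb - yk - s' • A' wb)) +
        (ca • (pa - yj - s • A va) + cb • (pb - yj - s • A vb)) - (c₀ + ca + cb) • (yk - yj - s • A vk) := by
    simp only [map_add, map_sub, map_neg, map_smul]
    module
  rw [e]
  have n1 := norm_combo3_le (c₀ := c₀) (c₁ := ca) (c₂ := cb) h₀ ha₁ hb₁
  have n2 : ‖ca • (pa - yj - s • A va) + cb • (pb - yj - s • A vb)‖ ≤ |ca| * (ε * s) + |cb| * (ε * s) := by
    refine (norm_add_le _ _).trans (add_le_add ?_ ?_) <;> rw [norm_smul, Real.norm_eq_abs]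
    · exact mul_le_mul_of_nonneg_left ha₂ (abs_nonneg _)
    · exact mul_le_mul_of_nonneg_left hb₂ (abs_nonneg _)
  have n3 : ‖(c₀ + ca + cb) • (yk - yj - s • A vk)‖ ≤ |c₀ + ca + cb| * (ε * s) := by
    rw [norm_smul, Real.norm_eq_abs]
    exact mul_le_mul_of_nonneg_left h₃ (abs_nonneg _)
  refine ((norm_sub_le _ _).trans (add_le_add ((norm_add_le _ _).trans (add_le_add (le_of_eq (norm_neg _)) le_rfl)) le_rfl)).trans ?_
  refine (add_le_add (add_le_add n1 n2) n3).trans (le_of_eq ?_)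
  ring

/-- ★ **SHARP FOUR-LABEL BOND LINK** (four partnered labels, no back-pointer): residual of `k` at `j` with coefficient `Σ c_r` — it vanishes for
the zero-sum representations of the non-face fcc lines (memo §5 (K3), cost 4). [this file · kind: new estimate] -/
theorem combo4_bound {A A' : E3 →ₗ[ℝ] E3} {s s' ε ca cb cc cd : ℝ} {yj yk pa pb pc pd vk va vb vc vd wa wb wc wd : E3}
    (ha₁ : ‖pa - yk - s' • A' wa‖ ≤ ε * s') (hb₁ : ‖pb - yk - s' • A' wb‖ ≤ ε * s') (hc₁ : ‖pc - yk - s' • A' wc‖ ≤ ε * s')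
    (hd₁ : ‖pd - yk - s' • A' wd‖ ≤ ε * s') (ha₂ : ‖pa - yj - s • A va‖ ≤ ε * s) (hb₂ : ‖pb - yj - s • A vb‖ ≤ ε * s)
    (hc₂ : ‖pc - yj - s • A vc‖ ≤ ε * s) (hd₂ : ‖pd - yj - s • A vd‖ ≤ ε * s) (h₃ : ‖yk - yj - s • A vk‖ ≤ ε * s) :
    ‖s' • A' (ca • wa + cb • wb + cc • wc + cd • wd) - s • A (ca • (va - vk) + cb • (vb - vk) + cc • (vc - vk) + cd • (vd - vk))‖ ≤
      ε * ((|ca| + |cb| + |cc| + |cd|) * s' + (|ca| + |cb| + |cc| + |cd| + |ca + cb + cc + cd|) * s) := by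
  have e : s' • A' (ca • wa + cb • wb + cc • wc + cd • wd) - s • A (ca • (va - vk) + cb • (vb - vk) + cc • (vc - vk) + cd • (vd - vk)) =
      -(ca • (pa - yk - s' • A' wa) + cb • (pb - yk - s' • A' wb) + cc • (pc - yk - s' • A' wc) + cd • (pd - yk - s' • A' wd)) +
        (ca • (pa - yj - s • A va) + cb • (pb - yj - s • A vb) + cc • (pc - yj - s • A vc) + cd • (pd - yj - s • A vd)) -
          (ca + cb + cc + cd) • (yk - yj - s • A vk) := by
    simp only [map_add, map_sub, map_smul]
    module
  rw [e]
  have n1 := norm_combo4_le (c₀ := ca) (c₁ := cb) (c₂ := cc) (c₃ := cd) ha₁ hb₁ hc₁ hd₁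
  have n2 := norm_combo4_le (c₀ := ca) (c₁ := cb) (c₂ := cc) (c₃ := cd) ha₂ hb₂ hc₂ hd₂
  have n3 : ‖(ca + cb + cc + cd) • (yk - yj - s • A vk)‖ ≤ |ca + cb + cc + cd| * (ε * s) := by
    rw [norm_smul, Real.norm_eq_abs]
    exact mul_le_mul_of_nonneg_left h₃ (abs_nonneg _)
  refine ((norm_sub_le _ _).trans (add_le_add ((norm_add_le _ _).trans (add_le_add (le_of_eq (norm_neg _)) le_rfl)) le_rfl)).trans ?_
  refine (add_le_add (add_le_add n1 n2) n3).trans (le_of_eq ?_)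
  ring

/-! ## §2 In the registration language of `…CompressedCutDict.dict_step` -/

/-- A registration clause read as a residual norm: `dist (p) (y + s·A v) ≤ b` is `‖p − y − s·A v‖ ≤ b`. [this file · kind: glue] -/
theorem residual_of_dist {p y w : E3} {b : ℝ} (h : dist p (y + w) ≤ b) : ‖p - y - w‖ ≤ b := by
  rwa [dist_eq_norm, ← sub_sub] at h

/-- ★ **FACE LINK** (registration form, generic `ε`).  Frames `(A, P, f)` at `j`, `(A′, P′, f′)` at `k = f v_k`; back-pointer `w₀ ∈ P′`
(`f′ w₀ = y j`) and two partnered labels `f′ w_a = f v_a`, `f′ w_b = f v_b` (delivered, with the exact dictionary values `R₁ w₀ = −v_k`,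
`R₁ w_r = v_r − v_k`, by `…CompressedCutExact.exact_step_record`).  For any coefficients the combination `x′ = c₀ w₀ + c_a w_a + c_b w_b`
is transported with the SHARP bound of `combo3_bound`. [this file · kind: new estimate] -/
theorem face_link {N : ℕ} {ε : ℝ} {y : Fin N → E3} {j k : Fin N} {A A' : E3 →ₗ[ℝ] E3} {P P' : Finset E3} {f f' : E3 → E3}
    (hfj : ∀ v ∈ P, f v ∈ Set.range y ∧ dist (f v) (y j + nearestDist y j • A v) ≤ ε * nearestDist y j)
    (hfk : ∀ w ∈ P', f' w ∈ Set.range y ∧ dist (f' w) (y k + nearestDist y k • A' w) ≤ ε * nearestDist y k)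
    {vk va vb w₀ wa wb : E3} (hvk : vk ∈ P) (hfvk : f vk = y k) (hva : va ∈ P) (hvb : vb ∈ P)
    (hw₀ : w₀ ∈ P') (hfw₀ : f' w₀ = y j) (hwa : wa ∈ P') (hfwa : f' wa = f va) (hwb : wb ∈ P') (hfwb : f' wb = f vb) (c₀ ca cb : ℝ) :
    ‖nearestDist y k • A' (c₀ • w₀ + ca • wa + cb • wb) - nearestDist y j • A (-(c₀ • vk) + ca • (va - vk) + cb • (vb - vk))‖ ≤
      ε * ((|c₀| + |ca| + |cb|) * nearestDist y k + (|ca| + |cb| + |c₀ + ca + cb|) * nearestDist y j) := by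
  have h₀ := residual_of_dist (hfk w₀ hw₀).2
  have ha₁ := residual_of_dist (hfk wa hwa).2
  have hb₁ := residual_of_dist (hfk wb hwb).2
  have ha₂ := residual_of_dist (hfj va hva).2
  have hb₂ := residual_of_dist (hfj vb hvb).2
  have h₃ := residual_of_dist (hfj vk hvk).2
  rw [hfw₀] at h₀
  rw [hfwa] at ha₁
  rw [hfwb] at hb₁
  rw [hfvk] at h₃
  exact combo3_bound h₀ ha₁ hb₁ ha₂ hb₂ h₃

/-- ★ **QUAD LINK** (registration form, generic `ε`): four partnered labels `f′ w_r = f v_r`, no back-pointer; the bound of `combo4_bound`.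
[this file · kind: new estimate] -/
theorem quad_link {N : ℕ} {ε : ℝ} {y : Fin N → E3} {j k : Fin N} {A A' : E3 →ₗ[ℝ] E3} {P P' : Finset E3} {f f' : E3 → E3}
    (hfj : ∀ v ∈ P, f v ∈ Set.range y ∧ dist (f v) (y j + nearestDist y j • A v) ≤ ε * nearestDist y j)
    (hfk : ∀ w ∈ P', f' w ∈ Set.range y ∧ dist (f' w) (y k + nearestDist y k • A' w) ≤ ε * nearestDist y k)
    {vk va vb vc vd wa wb wc wd : E3} (hvk : vk ∈ P) (hfvk : f vk = y k) (hva : va ∈ P) (hvb : vb ∈ P) (hvc : vc ∈ P) (hvd : vd ∈ P)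
    (hwa : wa ∈ P') (hfwa : f' wa = f va) (hwb : wb ∈ P') (hfwb : f' wb = f vb) (hwc : wc ∈ P') (hfwc : f' wc = f vc)
    (hwd : wd ∈ P') (hfwd : f' wd = f vd) (ca cb cc cd : ℝ) :
    ‖nearestDist y k • A' (ca • wa + cb • wb + cc • wc + cd • wd) -
        nearestDist y j • A (ca • (va - vk) + cb • (vb - vk) + cc • (vc - vk) + cd • (vd - vk))‖ ≤
      ε * ((|ca| + |cb| + |cc| + |cd|) * nearestDist y k + (|ca| + |cb| + |cc| + |cd| + |ca + cb + cc + cd|) * nearestDist y j) := by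
  have ha₁ := residual_of_dist (hfk wa hwa).2
  have hb₁ := residual_of_dist (hfk wb hwb).2
  have hc₁ := residual_of_dist (hfk wc hwc).2
  have hd₁ := residual_of_dist (hfk wd hwd).2
  have h₃ := residual_of_dist (hfj vk hvk).2
  rw [hfwa] at ha₁
  rw [hfwb] at hb₁
  rw [hfwc] at hc₁
  rw [hfwd] at hd₁
  rw [hfvk] at h₃
  exact combo4_bound ha₁ hb₁ hc₁ hd₁ (residual_of_dist (hfj va hva).2) (residual_of_dist (hfj vb hvb).2)
    (residual_of_dist (hfj vc hvc).2) (residual_of_dist (hfj vd hvd).2) h₃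

/-- **FACE LINK AT THE RECORD** `ε = 10⁻⁴`, coefficients of modulus `2/3` (the face representations `x′ = ±(2/3)(w₀ + w_a + w_b)` of memo §5
(K3)): the bound `10⁻⁴·(2ν_k + (10/3)ν_j)` — the constant 16/3. [this file · kind: new estimate] -/
theorem face_link_record {s s' c₀ ca cb L : ℝ} (hs : 0 ≤ s) (hc₀ : |c₀| = 2 / 3) (hca : |ca| = 2 / 3) (hcb : |cb| = 2 / 3)
    (hL : L ≤ 1 / 10 ^ 4 * ((|c₀| + |ca| + |cb|) * s' + (|ca| + |cb| + |c₀ + ca + cb|) * s)) :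
    L ≤ 1 / 10 ^ 4 * (2 * s' + 10 / 3 * s) := by
  have habc : |c₀ + ca + cb| ≤ 2 := by
    have := (abs_add_le (c₀ + ca) cb).trans (add_le_add (abs_add_le c₀ ca) le_rfl)
    linarith
  rw [hc₀, hca, hcb] at hL
  nlinarith

/-- **QUAD LINK AT THE RECORD**: moduli `2/3, 1/3, 2/3, 1/3` with zero sum (the non-face fcc lines of memo §5 (K3)): `10⁻⁴·(2ν_k + 2ν_j)`, the
constant 4. [this file · kind: new estimate] -/
theorem quad_link_record {s s' ca cb cc cd L : ℝ} (hca : |ca| = 2 / 3) (hcb : |cb| = 1 / 3) (hcc : |cc| = 2 / 3)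
    (hcd : |cd| = 1 / 3) (hsum : ca + cb + cc + cd = 0)
    (hL : L ≤ 1 / 10 ^ 4 * ((|ca| + |cb| + |cc| + |cd|) * s' + (|ca| + |cb| + |cc| + |cd| + |ca + cb + cc + cd|) * s)) :
    L ≤ 1 / 10 ^ 4 * (2 * s' + 2 * s) := by
  rw [hca, hcb, hcc, hcd, hsum, abs_zero] at hL
  linarith

/-! ## §3 The carried direction: chords, inner products, norms -/

/-- ★ **SHARP CHORD INEQUALITY** `‖û − v̂‖²·(‖u‖‖v‖) ≤ ‖u − v‖²` for nonzero `u, v` (from `‖u − v‖² − ‖u‖‖v‖·‖û − v̂‖² = (‖u‖ − ‖v‖)²`).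
[this file · kind: new estimate] -/
theorem chord_sq (u v : E3) (hu : u ≠ 0) (hv : v ≠ 0) :
    ‖(‖u‖⁻¹) • u - (‖v‖⁻¹) • v‖ ^ 2 * (‖u‖ * ‖v‖) ≤ ‖u - v‖ ^ 2 := by
  have hu' : 0 < ‖u‖ := norm_pos_iff.2 hu
  have hv' : 0 < ‖v‖ := norm_pos_iff.2 hv
  rw [@norm_sub_sq_real, @norm_sub_sq_real, norm_smul, norm_smul, norm_inv, norm_norm, norm_inv, norm_norm,
    inv_mul_cancel₀ hu'.ne', inv_mul_cancel₀ hv'.ne', real_inner_smul_left, real_inner_smul_right]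
  have hcs := abs_real_inner_le_norm u v
  have h1 : ‖u‖⁻¹ * (‖v‖⁻¹ * inner ℝ u v) * (‖u‖ * ‖v‖) = inner ℝ u v := by
    field_simp
  nlinarith [sq_nonneg (‖u‖ - ‖v‖), (abs_le.1 hcs).1, (abs_le.1 hcs).2, mul_pos hu' hv']

/-- ★ **CHORD BOUND**: norms at least `L > 0` and `‖u − v‖ ≤ δ` give `‖û − v̂‖ ≤ δ/L`. [this file · kind: new estimate] -/
theorem chord_le (u v : E3) {L δ : ℝ} (hL : 0 < L) (hu : L ≤ ‖u‖) (hv : L ≤ ‖v‖) (hd : ‖u - v‖ ≤ δ) :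
    ‖(‖u‖⁻¹) • u - (‖v‖⁻¹) • v‖ ≤ δ / L := by
  have hu' : 0 < ‖u‖ := hL.trans_le hu
  have hv' : 0 < ‖v‖ := hL.trans_le hv
  have hδ : 0 ≤ δ := (norm_nonneg _).trans hd
  have key := chord_sq u v (norm_pos_iff.1 hu') (norm_pos_iff.1 hv')
  set c := ‖(‖u‖⁻¹) • u - (‖v‖⁻¹) • v‖ with hc
  have hc0 : 0 ≤ c := norm_nonneg _
  have hLL : L ^ 2 ≤ ‖u‖ * ‖v‖ := by nlinarith
  have h2 : c ^ 2 * L ^ 2 ≤ δ ^ 2 := by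
    have := mul_le_mul_of_nonneg_left hLL (sq_nonneg c)
    nlinarith [pow_le_pow_left₀ (norm_nonneg _) hd 2]
  have h3 : c * L ≤ δ := by
    have h4 : (c * L) ^ 2 ≤ δ ^ 2 := by rw [mul_pow]; exact h2
    exact (pow_le_pow_iff_left₀ (mul_nonneg hc0 hL.le) hδ two_ne_zero).1 h4
  rw [le_div_iff₀ hL]
  exact h3

/-- **INNER PRODUCTS UNDER PERTURBATION**: `|⟪a, b⟫ − ⟪a′, b′⟫| ≤ ‖a − a′‖·‖b‖ + ‖a′‖·‖b − b′‖`; for unit `b, a′` the right side is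
`‖a − a′‖ + ‖b − b′‖` (chord errors add linearly into the cosine). [this file · kind: standard estimate] -/
theorem inner_perturb (a a' b b' : E3) : |⟪a, b⟫_ℝ - ⟪a', b'⟫_ℝ| ≤ ‖a - a'‖ * ‖b‖ + ‖a'‖ * ‖b - b'‖ := by
  have e : ⟪a, b⟫_ℝ - ⟪a', b'⟫_ℝ = ⟪a - a', b⟫_ℝ + ⟪a', b - b'⟫_ℝ := by
    rw [inner_sub_left, inner_sub_right]; ring
  rw [e]
  exact (abs_add_le _ _).trans (add_le_add (abs_real_inner_le_norm _ _) (abs_real_inner_le_norm _ _))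

/-- Unit form of `inner_perturb`. [this file · kind: standard estimate] -/
theorem inner_unit_perturb {a a' b b' : E3} (ha' : ‖a'‖ = 1) (hb : ‖b‖ = 1) :
    |⟪a, b⟫_ℝ - ⟪a', b'⟫_ℝ| ≤ ‖a - a'‖ + ‖b - b'‖ := by
  have := inner_perturb a a' b b'
  rwa [hb, ha', mul_one, one_mul] at this

/-- **NEAR-ISOMETRY ON A THREE-LABEL COMBINATION**: `‖A u − Q u‖ ≤ θ` on the three labels gives `‖A x − Q x‖ ≤ (|c₁| + |c₂| + |c₃|)·θ` for
`x = c₁u₁ + c₂u₂ + c₃u₃`. [this file · kind: glue] -/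
theorem near_isometry_combo3 {A : E3 →ₗ[ℝ] E3} {Q : E3 →ₗᵢ[ℝ] E3} {θ c₁ c₂ c₃ : ℝ} {u₁ u₂ u₃ : E3} (h₁ : ‖A u₁ - Q u₁‖ ≤ θ)
    (h₂ : ‖A u₂ - Q u₂‖ ≤ θ) (h₃ : ‖A u₃ - Q u₃‖ ≤ θ) :
    ‖A (c₁ • u₁ + c₂ • u₂ + c₃ • u₃) - Q (c₁ • u₁ + c₂ • u₂ + c₃ • u₃)‖ ≤ (|c₁| + |c₂| + |c₃|) * θ := by
  have e : A (c₁ • u₁ + c₂ • u₂ + c₃ • u₃) - Q (c₁ • u₁ + c₂ • u₂ + c₃ • u₃) =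
      c₁ • (A u₁ - Q u₁) + c₂ • (A u₂ - Q u₂) + c₃ • (A u₃ - Q u₃) := by
    simp only [map_add, map_smul, smul_sub]
    abel
  rw [e]
  refine (norm_combo3_le h₁ h₂ h₃).trans (le_of_eq ?_)
  ring

/-- ★ **NORM OF THE CARRIED VECTOR**: `‖A x − Q x‖ ≤ 2·10⁻³` (`near_isometry_combo3` with moduli summing to 2) and `‖x‖² = 8/3` give
`‖A x‖ ≥ 16309/10⁴` (`√(8/3) > 1.63299`). [this file · kind: new estimate] -/
theorem norm_face_lower {A : E3 →ₗ[ℝ] E3} {Q : E3 →ₗᵢ[ℝ] E3} {x : E3} (hx : ‖A x - Q x‖ ≤ 2 / 1000) (hn : ‖x‖ ^ 2 = 8 / 3) :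
    16309 / 10000 ≤ ‖A x‖ := by
  have hQ : ‖Q x‖ = ‖x‖ := Q.norm_map x
  have hx1 : 16329 / 10000 ≤ ‖x‖ := by nlinarith [norm_nonneg x]
  have := norm_sub_norm_le (Q x) (A x)
  rw [← norm_neg, neg_sub] at hx
  linarith

/-- The scaled form: `‖ν·A x‖ ≥ 16309/10⁴·ν`. [this file · kind: glue] -/
theorem norm_face_lower_scaled {A : E3 →ₗ[ℝ] E3} {Q : E3 →ₗᵢ[ℝ] E3} {x : E3} {ν : ℝ} (hν : 0 ≤ ν) (hx : ‖A x - Q x‖ ≤ 2 / 1000)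
    (hn : ‖x‖ ^ 2 = 8 / 3) : 16309 / 10000 * ν ≤ ‖ν • A x‖ := by
  rw [norm_smul, Real.norm_eq_abs, abs_of_nonneg hν, mul_comm]
  exact mul_le_mul_of_nonneg_left (norm_face_lower hx hn) hν

/-- ★ **PER-BOND CHORD CONSTANT (face case)**: under the scale window `9967/10⁴·ν_j ≤ ν_k ≤ 10011/10⁴·ν_j`, carried vectors of norm
`≥ 16309/10⁴·ν` at both ends and the 16/3-link `‖u − v‖ ≤ 10⁻⁴(2ν_k + (10/3)ν_j)`, the unit directions differ by at most `33/10⁵`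
(`5.3355/1.6255 = 3.28`). [this file · kind: new estimate] -/
theorem kappa_face {u v : E3} {νj νk : ℝ} (hν : 0 < νj) (hlo : 9967 / 10000 * νj ≤ νk) (hhi : νk ≤ 10011 / 10000 * νj)
    (hu : 16309 / 10000 * νk ≤ ‖u‖) (hv : 16309 / 10000 * νj ≤ ‖v‖) (hd : ‖u - v‖ ≤ 1 / 10 ^ 4 * (2 * νk + 10 / 3 * νj)) :
    ‖(‖u‖⁻¹) • u - (‖v‖⁻¹) • v‖ ≤ 33 / 10 ^ 5 := by
  have hL : 0 < 16255 / 10000 * νj := by positivity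
  have h := chord_le u v hL (by nlinarith) (by nlinarith) hd
  refine h.trans ?_
  rw [div_le_iff₀ hL]
  nlinarith

/-- **PER-BOND CHORD CONSTANT (quad case)**: with the 4-link `‖u − v‖ ≤ 10⁻⁴(2ν_k + 2ν_j)` the chord is at most `25/10⁵`. [this file · kind: new estimate] -/
theorem kappa_quad {u v : E3} {νj νk : ℝ} (hν : 0 < νj) (hlo : 9967 / 10000 * νj ≤ νk) (hhi : νk ≤ 10011 / 10000 * νj)
    (hu : 16309 / 10000 * νk ≤ ‖u‖) (hv : 16309 / 10000 * νj ≤ ‖v‖) (hd : ‖u - v‖ ≤ 1 / 10 ^ 4 * (2 * νk + 2 * νj)) :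
    ‖(‖u‖⁻¹) • u - (‖v‖⁻¹) • v‖ ≤ 25 / 10 ^ 5 := by
  have hL : 0 < 16255 / 10000 * νj := by positivity
  have h := chord_le u v hL (by nlinarith) (by nlinarith) hd
  refine h.trans ?_
  rw [div_le_iff₀ hL]
  nlinarith

/-- **CHORDS ALONG A LEG ADD UP**: a chain of unit vectors with consecutive chords `≤ κ` has end-to-end chord `≤ n·κ`. [this file · kind: glue] -/
theorem chord_chain (U : ℕ → E3) {κ : ℝ} (h : ∀ t, ‖U (t + 1) - U t‖ ≤ κ) : ∀ n : ℕ, ‖U n - U 0‖ ≤ n * κ := by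
  intro n
  induction n with
  | zero => simp
  | succ n ih =>
    have e : U (n + 1) - U 0 = (U (n + 1) - U n) + (U n - U 0) := by abel
    rw [e, Nat.cast_succ]
    exact (norm_add_le _ _).trans (by linarith [h n])

/-! ## §4 Budget lines of order (2c) at seventeen bonds per leg -/

/-- **FIRST-FOREIGN KILL BUDGET**: model cosine `1/3`, anchor `α = 245/10⁵`, one leg of `17` bonds at `κ = 33/10⁵`: `≤ 87/250`, the engine's `c`.
[this file · kind: computation] -/
theorem budget_kill : (1 : ℝ) / 3 + 245 / 10 ^ 5 + 17 * (33 / 10 ^ 5) ≤ 87 / 250 := by norm_num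

/-- **HUB BUDGET**: two legs of `17` bonds: `1/3 + 245/10⁵ + 34·33/10⁵ = 0.347003 ≤ 87/250` (margin `1.0·10⁻³`; the per-label constant `37/10⁵`
would give `0.34836 > 87/250`, memo §5). [this file · kind: computation] -/
theorem budget_hub : (1 : ℝ) / 3 + 245 / 10 ^ 5 + 2 * (17 * (33 / 10 ^ 5)) ≤ 87 / 250 := by norm_num

/-- The per-label constant does NOT fit two seventeen-bond legs (documentation of the decision for the sharp link). [this file · kind: computation] -/
theorem budget_hub_perlabel_fails : (87 : ℝ) / 250 < 1 / 3 + 245 / 10 ^ 5 + 2 * (17 * (37 / 10 ^ 5)) := by norm_num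

end Summit.AtomisticToContinuum.Crystallization.Theorems.OverbindingBudgetAffineRunCutBondLink
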